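import Summits.QuantumFields.BalabanUV.T4Continuum.Spine.NE1p.DressedAbsorptionWindow
import Summits.QuantumFields.BalabanUV.T4Continuum.Spine.NE1p.DressedPositionalCount

/-!
# T⁴ programme, spine estimate NE1′ (node O3b/H2) — LEAF L-B THROUGH THE ℝ-STEP SEAM WITH THE ABSORBED COUNT DERIVED FROM THE
# ℝ-STEP'S OWN GEOMETRY AND AN ANCHORING (swarm row «S5e» of `t4/formal/NE1p/LEAVES.md`, INTENT HOME/CLAIMS.log l.10487)

Cell `pub-balaban`, sub-cell `t4`, BINDER-OWNERS row NE1′ (owner lineage t4-ne1p-p1; root `Spine/NE1p/DressedRoot.lean` p211416); swarm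
unit `b2b-balaban-t4-ne1p-formalise-leaf-02` (gen 2); tree target `Summits/QuantumFields/BalabanUV/T4Continuum/Spine/NE1p/`; ADDITIVE —
imports the crew's landed `Spine/NE1p/DressedAbsorptionWindow` (row S5b ∘ S5, p212827 ∘ p212423) and `Spine/NE1p/DressedPositionalCount`
(row S4, p212703) ONLY; modifies nothing.

WHAT THIS FILE DOES.  Row S5 §3's ℝ-seam supplier `DressedBirthSuppliers.hbirth_of_rstep` concludes the field `BookingLeaves.hbirth` (leaf
L-B, (w1)+(w5b)) from row O3.E-iii-c's absorption datum `R : T4PreservedUnderR.RStep Bk` (absorbed families `R.absorbs`, strictly older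
by `RStep.absorbs_lt`), the seam hypotheses `PreBelowEnv` ∕ `AbsorbLaw`, dressing sizes and a K-free smallness — but it DISPLAYS a
positional count of the absorbed families, `#{b₀ ∈ R.absorbs b : j_{b₀} = j₀} ≤ M₀·U.Λ^{j_b−j₀}`, as a free hypothesis.  Here that
count is DERIVED from the ℝ-step's OWN fields — `RStep.absorbs_felt` (an absorbed birth is felt at a cube of the renormalised
component `R.comp b`), `RStep.comp_scale` (those cubes have the birth scale of `b`), `RStep.CompVol v` (at most `v` of them) — and a
block-lattice anchoring of the booking (`T4FeltGeometry.Anchoring.positionalCount_of_anchoring`, row S4's currency):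
* §1 `card_absorbs_filter_le` — under ANY `PositionalCount N`: `#{b₀ ∈ R.absorbs b : j_{b₀} = j₀} ≤ v·N j₀ j_b`;
  `count_absorbs_of_anchoring` — with an anchoring of per-block multiplicity `mB`: `≤ (v·mB)·((Lb:ℝ)^d)^{j_b−j₀}`.
* §2 `hbirth_of_rstep_anchored (U : UniformConstants)` — `BookingLeaves.hbirth` VERBATIM from `R`, the anchoring, `CompVol v`,
  `U.Λ = (Lb:ℝ)^d`, `PreBelowEnv`, `AbsorbLaw`, `β j ≤ β₀·U.τ^{K−j}` and the K-free smallness `β₀ + A·(v·mB)·U.A₀·(1−U.ρ′)⁻¹ ≤ U.A₀`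
  (`hbirth_of_rstep` BY NAME with its `hcount` discharged by §1).
* §3 `hbirth_of_rstep_cell` — the same at row S3's cell constants `uniformConstantsCell L C c̄ κ N₀ A₀ m s̄⁰ ρ′` (`(Lb:ℝ) = L`, `d = 4`),
  the smallness in row S5b's located form `fanout A (v·mB) ρ′ < 1` ∧ `absorbAmplitude β₀ A (v·mB) ρ′ ≤ A₀` (`absorbSmall_of_le`);
  conclusion = the `hbirth` family displayed by the END-ALL faces (S3e `dressedStability_of_ratioSchedules`) in plain currency.
EFFECT: leaf L-B reads DIRECTLY off the consumer row's own object `RStep` — no posited count, and row S3i's dictionary «absorbed ⊆ live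
families» (`hsub`) is replaced by the ℝ-step's built-in `absorbs_felt`.  DISPLAYED: `R`; `CompVol v` with ONE `v` before `∀ a K` —
the located instantiation demand on the renormalised large-field components (caveat k1 ∕ R4 of row S4: K-free for COLLARED components,
NOT asserted for Bałaban's components); `PreBelowEnv` (the 𝕋-side of the seam, wall-adjacent (w5)); `AbsorbLaw` («budgets add» — from
`RStep.Absorbs A`, printed format [Balaban1989LargeFieldII] (1.69) p. 377 as CONTEXT only, by `absorbLaw_of_absorbs`); `β`, `A`, `β₀`;
the anchoring and its multiplicity `mB`.

HONEST FRAMING.  [folklore] kernel bookkeeping over HYPOTHESIS SHAPES; 0 sorry; 0 citations used as facts; NO `def … : Prop` minted;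
nothing of Bałaban's densities, components or D-terms is asserted.  Headline (c4): «L-B ⇐ the ℝ-step's absorption data + anchoring +
component volume + the located fan-out window», NEVER «NE1′ proved»; NE1′ is NOT PRINTED and NOT PROVED; 0 binders instantiated on
Bałaban's densities; spine PROVED 0∕9 unchanged.  Rung (B)+1 on ONE finite four-torus — NOT infinite volume, NOT a mass gap, NOT the
Clay problem, NOT summit progress.  HONEST DEPENDENCY: continuum YM on T⁴ ⇐ BetaPertH ∧ nine spine estimates (0/9 proved); BetaPertH ⇐
(D1) ∧ (D4) ∧ CAP+tail; G-an2-4 gates asym, D1 and NE2/3/4.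
-/

noncomputable section

namespace Summit.QuantumFields.BalabanUV.T4Continuum.NE1p.DressedBirthRStepAnchored

open Finset
open scoped BigOperators
open Literature.MathematicalPhysics.QuantumFieldTheory.Balaban1983to89
open Literature.MathematicalPhysics.QuantumFieldTheory.Balaban1983to89.T4TermFormat
open Literature.MathematicalPhysics.QuantumFieldTheory.Balaban1983to89.T4TermFormat.Booking
open Literature.MathematicalPhysics.QuantumFieldTheory.Balaban1983to89.T4FeltGeometry
open Literature.MathematicalPhysics.QuantumFieldTheory.Balaban1983to89.T4TrajectoryComparison
open Literature.MathematicalPhysics.QuantumFieldTheory.Balaban1983to89.T4PreservedUnderR (RStep)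
open Summit.QuantumFields.BalabanUV.T4Continuum.T4TrajectoryDensityDressed
open Summit.QuantumFields.BalabanUV.T4Continuum.NE1p.DressedRoot
open Summit.QuantumFields.BalabanUV.T4Continuum.NE1p.DressedBirthSuppliers
open Summit.QuantumFields.BalabanUV.T4Continuum.NE1p.DressedUniformConstants
open Summit.QuantumFields.BalabanUV.T4Continuum.NE1p.DressedAbsorptionWindow
open Summit.QuantumFields.BalabanUV.T4Continuum.NE1p.DressedPositionalCount

variable {Bk : T4TermFormat.Booking}

/-! ## §1 The absorbed families are counted by the ℝ-step's component geometry -/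

/-- **THE ABSORBED COUNT FROM THE ℝ-STEP'S OWN FIELDS** [bookkeeping]: every absorbed family of `b` is felt at a cube of the
renormalised component `R.comp b` (`RStep.absorbs_felt`), whose cubes have the birth scale of `b` (`RStep.comp_scale`) and number at most
`v` (`RStep.CompVol v`); so under a positional count `N` of the booking the absorbed families of birth scale `j₀` number at most
`v·N j₀ j_b` (they sit in the union over the component's cubes of the scale-`j₀` births felt there; `card_biUnion_le`). [folklore] -/
theorem card_absorbs_filter_le (R : RStep Bk) {N : ℕ → ℕ → ℝ} {v : ℕ} (hN : Bk.PositionalCount N) (hN0 : ∀ j k, 0 ≤ N j k)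
    (hv : R.CompVol v) (b : Bk.Birth) (j₀ : ℕ) :
    (((R.absorbs b).filter fun b₀ => Bk.birthScale b₀ = j₀).card : ℝ) ≤ (v : ℝ) * N j₀ (Bk.birthScale b) := by
  classical
  have hsub : ((R.absorbs b).filter fun b₀ => Bk.birthScale b₀ = j₀) ⊆ (R.comp b).biUnion fun q => Bk.feltOfScale q j₀ := by
    intro b₀ hb₀
    obtain ⟨hbabs, hj⟩ := mem_filter.mp hb₀
    obtain ⟨q, hq, hfq⟩ := R.absorbs_felt b b₀ hbabs
    exact mem_biUnion.mpr ⟨q, hq, Booking.mem_feltOfScale.mpr ⟨hfq, hj⟩⟩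
  have h1 : (((R.absorbs b).filter fun b₀ => Bk.birthScale b₀ = j₀).card : ℝ)
      ≤ ∑ q ∈ R.comp b, ((Bk.feltOfScale q j₀).card : ℝ) := by
    have := (card_le_card hsub).trans (card_biUnion_le (s := R.comp b) (t := fun q => Bk.feltOfScale q j₀))
    exact_mod_cast this
  calc (((R.absorbs b).filter fun b₀ => Bk.birthScale b₀ = j₀).card : ℝ)
      ≤ ∑ q ∈ R.comp b, ((Bk.feltOfScale q j₀).card : ℝ) := h1
    _ ≤ ∑ q ∈ R.comp b, N j₀ (Bk.birthScale b) := sum_le_sum fun q hq => by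
        have h := hN q j₀
        rw [R.comp_scale b q hq] at h
        exact h
    _ = ((R.comp b).card : ℝ) * N j₀ (Bk.birthScale b) := by rw [sum_const, nsmul_eq_mul]
    _ ≤ (v : ℝ) * N j₀ (Bk.birthScale b) := mul_le_mul_of_nonneg_right (by exact_mod_cast hv b) (hN0 j₀ _)

/-- **THE ABSORBED COUNT FROM AN ANCHORING** [bookkeeping]: with a block-lattice anchoring of blocking factor `Lb > 0` and
per-block multiplicity `mB` (`Anchoring.positionalCount_of_anchoring`: `PositionalCount (mB·((Lb)^d)^{k−j})`) and `CompVol v`, the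
absorbed families of `b` of birth scale `j₀` number at most `(v·mB)·((Lb:ℝ)^d)^{j_b−j₀}` — the positional form consumed by
`DressedBirthSuppliers.hbirth_of_rstep` with `M₀ = v·mB`, `Λ = Lb^d`. [folklore] -/
theorem count_absorbs_of_anchoring (R : RStep Bk) {d Lb : ℕ} (Anch : Anchoring Bk d Lb) (hLb : 0 < Lb) {mB v : ℕ}
    (hmult : ∀ j (x : Fin d → ℕ), (Bk.births.filter fun b => Bk.birthScale b = j ∧ x ∈ Anch.dom b).card ≤ mB)
    (hv : R.CompVol v) :
    ∀ (b : Bk.Birth) (j₀ : ℕ), (((R.absorbs b).filter fun b₀ => Bk.birthScale b₀ = j₀).card : ℝ)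
      ≤ ((v : ℝ) * mB) * ((Lb : ℝ) ^ d) ^ (Bk.birthScale b - j₀) := by
  intro b j₀
  refine (card_absorbs_filter_le R (Anch.positionalCount_of_anchoring hLb hmult) (fun j k => by positivity) hv b j₀).trans ?_
  rw [mul_assoc]

/-! ## §2 Leaf L-B from the ℝ-step seam, the absorbed count discharged (any `UniformConstants`) -/

/-- **LEAF L-B FROM THE ℝ-STEP SEAM — `BookingLeaves.hbirth` VERBATIM, NO POSITED COUNT** [bookkeeping]: for uniform constants `U`
whose count rate is the anchoring's (`U.Λ = (Lb:ℝ)^d`), row O3.E-iii-c's absorption datum `R : RStep Bk` with component volume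
`CompVol v`, an anchoring of multiplicity `mB`, the pre-ℝ sizes below the transported envelope under the dressed gate
(`T.PreBelowEnv R U.C ρ (budgetGate …)`), the absorption law `T.AbsorbLaw R U.C β A` («budgets add»), dressing sizes
`β j ≤ β₀·U.τ^{K−j}` and the K-FREE smallness `β₀ + A·(v·mB)·U.A₀·(1−U.ρ′)⁻¹ ≤ U.A₀` ⟹ `hbirth` — `DressedBirthSuppliers.hbirth_of_rstep`
BY NAME, its displayed `hcount` supplied by `count_absorbs_of_anchoring`. [folklore] -/
theorem hbirth_of_rstep_anchored (U : UniformConstants) (T : Trajectory Bk) (R : RStep Bk) (ρ : ℕ → ℝ) (s₀ : Bk.Birth → ℕ → ℝ)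
    (S : ℕ → Bk.Birth → Finset Bk.Birth) {d Lb : ℕ} (Anch : Anchoring Bk d Lb) (hLb : 0 < Lb) {mB v : ℕ}
    (hmult : ∀ j (x : Fin d → ℕ), (Bk.births.filter fun b => Bk.birthScale b = j ∧ x ∈ Anch.dom b).card ≤ mB)
    (hv : R.CompVol v) (hΛ : U.Λ = (Lb : ℝ) ^ d) {β : ℕ → ℝ} {A β₀ : ℝ} (hA : 0 ≤ A)
    (hpre : T.PreBelowEnv R U.C ρ (budgetGate T s₀ U.m S U.C ρ)) (hlaw : T.AbsorbLaw R U.C β A)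
    (hβ : ∀ j, j ≤ Bk.K → β j ≤ β₀ * U.τ ^ (Bk.K - j))
    (hsmall : β₀ + A * ((v : ℝ) * mB) * U.A₀ * (1 - U.ρ')⁻¹ ≤ U.A₀) :
    T.BirthsFromOld U.C ρ (twoRate U.A₀ U.ρ₁ U.τ Bk.K) (budgetGate T s₀ U.m S U.C ρ) :=
  hbirth_of_rstep U T R ρ s₀ S (M₀ := (v : ℝ) * mB)
    (fun b j₀ => by rw [hΛ]; exact count_absorbs_of_anchoring R Anch hLb hmult hv b j₀) hA (by positivity) hpre hlaw hβ
    hsmall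

/-! ## §3 At row S3's cell constants, the smallness in the located fan-out form -/

/-- **LEAF L-B FROM THE ℝ-STEP SEAM AT THE CELL CONSTANTS** [bookkeeping]: with row S3's `uniformConstantsCell L C c̄ κ N₀ A₀ m s̄⁰ ρ′`
(`Λ = L⁴`, `τ = L⁻³`, `ρ₁ = rhoOne L⁻² C c̄ κ`), the cell's blocking integer `(Lb:ℝ) = L` anchoring the booking on `ℕ⁴` with
multiplicity `mB`, the ℝ-step `R` with `CompVol v`, `PreBelowEnv` under the dressed gate, `AbsorbLaw`, dressing sizes
`β j ≤ β₀·(L⁻³)^{K−j}`, and row S5b's two located numbers `fanout A (v·mB) ρ′ < 1`, `absorbAmplitude β₀ A (v·mB) ρ′ ≤ A₀` ⟹ the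
`hbirth` family displayed by the END-ALL faces, in plain currency (`§2` at the cell + `absorbSmall_of_le`).  «Absorption constant `A`
at mergers, fan-out of the absorbed count below one» — nothing else; `CompVol v` with ONE `v` is the located instantiation demand
(k1 ∕ R4), displayed. [folklore] -/
theorem hbirth_of_rstep_cell {L C cbar κ N₀ A₀ m sbar ρ' : ℝ} (hL : 1 ≤ L) (hC : 0 ≤ C) (hcbar : 0 ≤ cbar) (hκ : 0 ≤ κ)
    (hN₀ : 0 ≤ N₀) (hA₀ : 0 ≤ A₀) (hm : 0 ≤ m) (hloc : locCell L C cbar κ ≤ ρ') (hρ'1 : ρ' < 1)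
    (hsmall : m * (N₀ * A₀ * (1 - ρ')⁻¹) ≤ 1 - sbar) (T : Trajectory Bk) (R : RStep Bk) (ρ : ℕ → ℝ)
    (s₀ : Bk.Birth → ℕ → ℝ) (S : ℕ → Bk.Birth → Finset Bk.Birth) {Lb : ℕ} (Anch : Anchoring Bk 4 Lb) (hLb : (Lb : ℝ) = L)
    {mB v : ℕ} (hmult : ∀ j (x : Fin 4 → ℕ), (Bk.births.filter fun b => Bk.birthScale b = j ∧ x ∈ Anch.dom b).card ≤ mB)
    (hv : R.CompVol v) {β : ℕ → ℝ} {A β₀ : ℝ} (hA : 0 ≤ A)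
    (hpre : T.PreBelowEnv R C ρ (budgetGate T s₀ m S C ρ)) (hlaw : T.AbsorbLaw R C β A)
    (hβ : ∀ j, j ≤ Bk.K → β j ≤ β₀ * (L⁻¹ ^ 3) ^ (Bk.K - j))
    (hfan : fanout A ((v : ℝ) * mB) ρ' < 1) (hamp : absorbAmplitude β₀ A ((v : ℝ) * mB) ρ' ≤ A₀) :
    T.BirthsFromOld C ρ (twoRate A₀ (rhoOne (L ^ 2)⁻¹ C cbar κ) (L⁻¹ ^ 3) Bk.K) (budgetGate T s₀ m S C ρ) := by
  have hLb0 : 0 < Lb := by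
    have h : (0 : ℝ) < (Lb : ℝ) := by rw [hLb]; linarith
    exact_mod_cast h
  have hsm : β₀ + A * ((v : ℝ) * mB) * A₀ * (1 - ρ')⁻¹ ≤ A₀ := absorbSmall_of_le hfan hamp
  exact hbirth_of_rstep_anchored (uniformConstantsCell L C cbar κ N₀ A₀ m sbar ρ' hL hC hcbar hκ hN₀ hA₀ hm hloc hρ'1 hsmall)
    T R ρ s₀ S Anch hLb0 hmult hv (by rw [uniformConstantsCell_Λ, ← hLb]) hA hpre hlaw hβ hsm

end Summit.QuantumFields.BalabanUV.T4Continuum.NE1p.DressedBirthRStepAnchored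

end
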